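/-
Copyright: solo-informed seat (gen 55), 2026-08-28. Problem-side theorems (sorry-free).
-/
import Literature.Barriers.MatrixMultiplication.IrreversibilityBarrierGaugeBounds
import Literature.Barriers.MatrixMultiplication.IrreversibilityBarrierAssembly
import HarnessLib

/-!
# The corner big centroid tensors `T_{1,1,r}` of Kassabov–Landsberg–Souza–Speegle sit inside the
irreversibility barrier — every row of their laser-method table is capped above `2.2`

Companion to `SoloInformedBigCentroidBarrier` (the balanced family `T_{n,n,n}`; literature watch of
2026-08-28, arXiv:2608.27434). Table 1 of [KLSS26, §8] runs Strassen's laser method "off the shelf" on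
`T^{bigcen}_{1,1,r}` (`r = 2, …, 7`; best value `ω ≤ 2.46016` at `r = 4`) and on `T^{bigcen}_{2,2,2}`
(`ω ≤ 2.5`), and leaves the analysis of Kronecker powers "to future work" (p. 37). For the purpose of
`ω = 2` (constraint C2 of this programme's sharpest statement, `EXECUTIVE.md` §2: a fixed irreversible
intermediate tensor cannot certify `ω = 2`, Christandl–Vrana–Zuiddam) that future work is capped in
advance, Kronecker powers included, and this file puts the cap in the kernel for the whole corner family.

In coordinates, `T_{1,1,r} = a₀ b₀ c₀ + Σ_{k=1}^{r} (a_k b₀ c_k + a₀ b_k c_k) ∈ (K^{r+1})^{⊗3}`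
([KLSS26, Ex. 2.2] with `p = q = 1`: `a₀ = a_1`, `a_k = a_{1k}`, `b₀ = b_1`, `b_k = b_{1k}`,
`c₀ = c_{11}`, `c_k = c_k`). It is Strassen's tensor `Str_r` plus the block `⟨1,1,1⟩ = a₀ b₀ c₀`
("unrestrictions of the Strassen tensors", [KLSS26, §6.5 and Table 1]); equivalently it is the
structure tensor of the commutative local algebra `K[t₁, …, t_r]/(t₁, …, t_r)²` (coefficient of `1` ↦ `c₀`,
of `t_k` ↦ `c_k`), so for `r = 2` it is the boundary class `T_{K[x,y]/𝔪²}` of the door tensor `T_{cw,2}`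
recorded in `SoloInformedCwTwoBoundary` (`P ⊵ T_{K[x,y]/𝔪²}` iff `char K ≠ 2`): KLSS's smallest new laser
carrier lies in the orbit closure of the door tensor.

## What is proved (every field `K`, every `r ≥ 2`)

* `flatteningRank_cornerTensor`: the first flattening of `T_{1,1,r}` is injective (`a₀` acts by the
  identity matrix — `T_{1,1,r}` is `1_A`-generic, `cornerTensor_inl`), so `ζ⁽¹⁾ = r + 1` and
  `ω(⟨2⟩, T_{1,1,r}) ≥ log₂(r+1)` (CVZ Prop. 17: `R̃ ≥` flattening rank).
* `ccWeight_supp`: the weights `w_A = w_B = (a₀ ↦ 1/2, a_k ↦ 1/(2r))`, `w_C = (c₀ ↦ 1/(r²+1),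
  c_k ↦ r/(r²+1))` cover the (tight) support WITH EQUALITY: every support point has weight product
  `1/(4(r²+1)) = θ_r³`. Hence (CVZ §4.2, `inv_logb_le_relativeExponent_of_weights`)
  `Q̃(T_{1,1,r}) ≤ (4(r²+1))^{1/3}` and `ω(T_{1,1,r}, ⟨2⟩) ≥ 3/(2 + log₂(r²+1))`
  (`inv_le_relativeExponent_cornerTensor_unit`). For comparison, the support is tight, so Strassen's
  formula gives the exact value `Q̃(T_{1,1,r}) = 2√r` for `r ≥ 4` (`= 4 < 4.082` at `r = 4`); the rational
  certificate is what the kernel needs and already lies below `r + 1` for every `r ≥ 2`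
  (`(r+1)³ − 4(r²+1) = (r−1)(r²+3) > 0`, `two_lt_cornerBarrierValue`).
* `irreversibilityBarrier_corner`: by `IrreversibilityBarrier_holds.thm9` every bound on `ω` certified
  through the fixed intermediate `T_{1,1,r}` satisfies
  `ω(⟨2⟩, T_{1,1,r}) · ω(T_{1,1,r}, ⟨2,2,2⟩) ≥ 6 log₂(r+1) / (2 + log₂(r²+1))`, which is
  `2.2004 (r=2), 2.2548 (3), 2.2886 (4), 2.3147 (5), 2.3364 (6), 2.3548 (7)`, increasing to `3`;
  `irreversibilityBarrier_corner_gt_two`: it is `> 2` for every `r ≥ 2`. (`r = 1` is the `W`-state,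
  `2i = 2.18`, covered by `irreversibilityBarrier_cw`-type certificates with unequal weights; `r = 0` is
  `⟨1⟩`.)

Consequence for the dossier: every tensor of [KLSS26, Table 1] is an irreversible carrier (this file and
`BigCentroid.irreversibilityBarrier_bigcen_gt_two` for `T_{2,2,2}`, value `2.2961`); none can serve as the
intermediate tensor of a proof of `ω = 2`, with or without Kronecker powers; qualitatively this is also
Bläser–Lysikov's theorem for structure tensors of algebras with nonzero radical
(`Literature.Barriers.MatrixMultiplication.UnstableTensorBarrier`, `BlaserLysikov2020_thm17`), made
quantitative here. Not treated: the unrestricted Schönhage tensors `T⁺⁺_{Sch,u,v}` of [KLSS26, Table 2].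

References: [KassabovEtAl2026] = arXiv:2608.27434 (Ex. 2.2, §6.5, §8 Table 1, p. 37);
[ChristandlVranaZuiddam2021] (Def. 4, Prop. 17, §4.2, Thm. 9); [BlaserLysikov2020, Thm. 17].
-/

namespace Summit.MatrixMultiplication.MatrixMultiplication.Theorems

open Literature.Computability.AlgebraicComplexity
open Literature.Barriers.MatrixMultiplication
open scoped BigOperators

namespace BigCentroidCorner

/-! ## The tensor -/

/-- Index type of each factor of `T_{1,1,r}`: the distinguished coordinate (`a₀`, `b₀`, `c₀`) and the
`r` others. [cite: KassabovEtAl2026, Ex. 2.2] -/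
abbrev CIdx (r : ℕ) : Type := Unit ⊕ Fin r

/-- `|Unit ⊕ Fin r| = r + 1`. [folklore] -/
theorem card_cidx (r : ℕ) : Fintype.card (CIdx r) = r + 1 := by
  simp [Fintype.card_sum, Fintype.card_fin, add_comm]

variable (K : Type) [Field K]

/-- The **corner big centroid tensor** `T_{1,1,r} = a₀ b₀ c₀ + Σ_k (a_k b₀ c_k + a₀ b_k c_k)`
(`= Str_r + ⟨1,1,1⟩ =` structure tensor of `K[t₁,…,t_r]/𝔪²`). [cite: KassabovEtAl2026, Ex. 2.2] -/
def cornerTensor (r : ℕ) : CIdx r → CIdx r → CIdx r → K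
  | Sum.inl _, Sum.inl _, Sum.inl _ => 1
  | Sum.inr k, Sum.inl _, Sum.inr k' => if k = k' then 1 else 0
  | Sum.inl _, Sum.inr k, Sum.inr k' => if k = k' then 1 else 0
  | Sum.inl _, Sum.inl _, Sum.inr _ => 0
  | Sum.inl _, Sum.inr _, Sum.inl _ => 0
  | Sum.inr _, Sum.inl _, Sum.inl _ => 0
  | Sum.inr _, Sum.inr _, _ => 0

variable {K} {r : ℕ}

/-- Entry `(a₀, b₀, c₀) = 1`. [cite: KassabovEtAl2026, Ex. 2.2] -/
@[simp] theorem corner_lll (u u' u'' : Unit) :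
    cornerTensor K r (Sum.inl u) (Sum.inl u') (Sum.inl u'') = 1 := rfl

/-- Entry `(a_k, b₀, c_{k'}) = [k = k']`. [cite: KassabovEtAl2026, Ex. 2.2] -/
@[simp] theorem corner_rlr (k : Fin r) (u : Unit) (k' : Fin r) :
    cornerTensor K r (Sum.inr k) (Sum.inl u) (Sum.inr k') = if k = k' then 1 else 0 := rfl

/-- Entry `(a₀, b_k, c_{k'}) = [k = k']`. [cite: KassabovEtAl2026, Ex. 2.2] -/
@[simp] theorem corner_lrr (u : Unit) (k k' : Fin r) :
    cornerTensor K r (Sum.inl u) (Sum.inr k) (Sum.inr k') = if k = k' then 1 else 0 := rfl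

/-- Entry `(a₀, b₀, c_k) = 0`. [cite: KassabovEtAl2026, Ex. 2.2] -/
@[simp] theorem corner_llr (u u' : Unit) (k : Fin r) :
    cornerTensor K r (Sum.inl u) (Sum.inl u') (Sum.inr k) = 0 := rfl

/-- Entry `(a₀, b_k, c₀) = 0`. [cite: KassabovEtAl2026, Ex. 2.2] -/
@[simp] theorem corner_lrl (u : Unit) (k : Fin r) (u' : Unit) :
    cornerTensor K r (Sum.inl u) (Sum.inr k) (Sum.inl u') = 0 := rfl

/-- Entry `(a_k, b₀, c₀) = 0`. [cite: KassabovEtAl2026, Ex. 2.2] -/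
@[simp] theorem corner_rll (k : Fin r) (u u' : Unit) :
    cornerTensor K r (Sum.inr k) (Sum.inl u) (Sum.inl u') = 0 := rfl

/-- Two non-distinguished coordinates in `A` and `B` never meet the support (`𝔪² = 0`).
[cite: KassabovEtAl2026, Ex. 2.2] -/
@[simp] theorem corner_rr (k k' : Fin r) (c : CIdx r) :
    cornerTensor K r (Sum.inr k) (Sum.inr k') c = 0 := by cases c <;> rfl

/-- **`T_{1,1,r}` is `1_A`-generic**: the slice at `a₀` is the identity matrix (the unit of the
algebra `K[t]/𝔪²`). [cite: KassabovEtAl2026, Ex. 2.2] -/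
theorem cornerTensor_inl (u : Unit) (b c : CIdx r) :
    cornerTensor K r (Sum.inl u) b c = if b = c then 1 else 0 := by
  rcases b with u' | k <;> rcases c with u'' | k'
  · cases u'; cases u''; simp
  · simp
  · simp
  · simp [Sum.inr.injEq]

/-! ## `R̃`-side: the first flattening is injective -/

/-- The `x`-slices of `T_{1,1,r}` are linearly independent (read off the entries `(·, b₀, c₀)` and
`(·, b₀, c_k)`). [cite: KassabovEtAl2026, Ex. 2.2] -/
theorem linearIndependent_xSlices_corner : LinearIndependent K (xSlices (cornerTensor K r)) := by
  rw [Fintype.linearIndependent_iff]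
  intro g hg
  have ev : ∀ b c : CIdx r, ∑ a, g a * cornerTensor K r a b c = 0 := fun b c => by
    have h := congr_fun hg (b, c)
    simpa [Finset.sum_apply, Pi.smul_apply, smul_eq_mul] using h
  rintro (u | k)
  · cases u
    have h := ev (Sum.inl ()) (Sum.inl ())
    rw [Finset.sum_eq_single (Sum.inl () : CIdx r) (fun b _ hb => ?_) (by simp)] at h
    · simpa using h
    · rcases b with u' | k'
      · cases u'; exact (hb rfl).elim
      · simp
  · have h := ev (Sum.inl ()) (Sum.inr k)
    rw [Finset.sum_eq_single (Sum.inr k : CIdx r) (fun b _ hb => ?_) (by simp)] at h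
    · simpa using h
    · rcases b with u' | k'
      · simp
      · have hk : k' ≠ k := fun e => hb (by rw [e])
        simp [hk]

/-- **`ζ⁽¹⁾(T_{1,1,r}) = r + 1`** (`T_{1,1,r}` is `A`-concise). [cite: KassabovEtAl2026, Ex. 2.2] -/
theorem flatteningRank_cornerTensor : flatteningRank (cornerTensor K r) = r + 1 := by
  rw [flatteningRank, finrank_span_eq_card linearIndependent_xSlices_corner, card_cidx]

/-- **`ω(⟨2⟩, T_{1,1,r}) ≥ log₂(r+1)`** (CVZ Prop. 17: `R̃ ≥` flattening rank).
[cite: ChristandlVranaZuiddam2021, Prop. 17] -/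
theorem logb_le_relativeExponent_unit_cornerTensor :
    Real.logb 2 ((r : ℝ) + 1) ≤ relativeExponent (unitTensor K 2) (cornerTensor K r) := by
  have h := logb_flatteningRank_le_relativeExponent (K := K) (cornerTensor K r)
  rw [flatteningRank_cornerTensor] at h
  push_cast at h
  exact h

/-! ## `Q̃`-side: a cross-entropy certificate covering the support with equality -/

/-- Weights on `A` (and on `B`): `a₀ ↦ 1/2`, `a_k ↦ 1/(2r)`. [cite: ChristandlVranaZuiddam2021, §4.2] -/
noncomputable def ccWeightAB (r : ℕ) : CIdx r → ℝ :=
  Sum.elim (fun _ => 1 / 2) (fun _ => 1 / (2 * (r : ℝ)))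

/-- Weights on `C`: `c₀ ↦ 1/(r²+1)`, `c_k ↦ r/(r²+1)`. [cite: ChristandlVranaZuiddam2021, §4.2] -/
noncomputable def ccWeightC (r : ℕ) : CIdx r → ℝ :=
  Sum.elim (fun _ => 1 / ((r : ℝ) ^ 2 + 1)) (fun _ => (r : ℝ) / ((r : ℝ) ^ 2 + 1))

/-- `w_A ≥ 0`. [folklore] -/
theorem ccWeightAB_nonneg (r : ℕ) (a : CIdx r) : 0 ≤ ccWeightAB r a := by
  rcases a with u | k <;> simp only [ccWeightAB, Sum.elim_inl, Sum.elim_inr] <;> positivity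

/-- `w_C ≥ 0`. [folklore] -/
theorem ccWeightC_nonneg (r : ℕ) (c : CIdx r) : 0 ≤ ccWeightC r c := by
  rcases c with u | k <;> simp only [ccWeightC, Sum.elim_inl, Sum.elim_inr] <;> positivity

/-- `Σ w_A = 1/2 + r · 1/(2r) = 1` (`r ≥ 1`). [folklore] -/
theorem sum_ccWeightAB (hr : 1 ≤ r) : ∑ a, ccWeightAB r a = 1 := by
  have hr0 : (r : ℝ) ≠ 0 := by exact_mod_cast (show r ≠ 0 by omega)
  simp only [ccWeightAB, Fintype.sum_sum_type, Sum.elim_inl, Sum.elim_inr, Finset.sum_const,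
    Finset.card_univ, Fintype.card_unit, Fintype.card_fin, nsmul_eq_mul]
  push_cast
  field_simp
  ring

/-- `Σ w_C = 1/(r²+1) + r · r/(r²+1) = 1`. [folklore] -/
theorem sum_ccWeightC (r : ℕ) : ∑ c, ccWeightC r c = 1 := by
  have h1 : ((r : ℝ) ^ 2 + 1) ≠ 0 := by positivity
  simp only [ccWeightC, Fintype.sum_sum_type, Sum.elim_inl, Sum.elim_inr, Finset.sum_const,
    Finset.card_univ, Fintype.card_unit, Fintype.card_fin, nsmul_eq_mul]
  push_cast
  field_simp
  ring

/-- `θ_r = (1/(4(r²+1)))^{1/3}`; `1/θ_r = (4(r²+1))^{1/3}` is the certified upper bound for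
`Q̃(T_{1,1,r})`. [cite: ChristandlVranaZuiddam2021, §4.2] -/
noncomputable def ccTheta (r : ℕ) : ℝ := (1 / (4 * ((r : ℝ) ^ 2 + 1))) ^ ((3 : ℝ)⁻¹)

/-- `1/(4(r²+1)) > 0`. [folklore] -/
theorem ccTheta_arg_pos (r : ℕ) : (0 : ℝ) < 1 / (4 * ((r : ℝ) ^ 2 + 1)) := by positivity

/-- `θ_r > 0`. [folklore] -/
theorem ccTheta_pos (r : ℕ) : 0 < ccTheta r := Real.rpow_pos_of_pos (ccTheta_arg_pos r) _

/-- `θ_r³ = 1/(4(r²+1))`. [folklore] -/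
theorem ccTheta_pow_three (r : ℕ) : ccTheta r ^ 3 = 1 / (4 * ((r : ℝ) ^ 2 + 1)) := by
  unfold ccTheta
  have h := Real.rpow_inv_natCast_pow (x := 1 / (4 * ((r : ℝ) ^ 2 + 1))) (n := 3) (by positivity)
    (by norm_num)
  push_cast at h
  exact h

/-- `θ_r < 1` (`1 < 4(r²+1)`). [folklore] -/
theorem ccTheta_lt_one (r : ℕ) : ccTheta r < 1 := by
  unfold ccTheta
  refine Real.rpow_lt_one (ccTheta_arg_pos r).le ?_ (by norm_num)
  rw [div_lt_one (by positivity)]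
  nlinarith [sq_nonneg (r : ℝ)]

/-- `log₂(1/θ_r) = (2 + log₂(r²+1))/3`. [folklore] -/
theorem logb_inv_ccTheta (r : ℕ) :
    Real.logb 2 (1 / ccTheta r) = (2 + Real.logb 2 ((r : ℝ) ^ 2 + 1)) / 3 := by
  rw [one_div, Real.logb_inv, ccTheta, Real.logb_rpow_eq_mul_logb_of_pos (ccTheta_arg_pos r),
    Real.logb_div (by norm_num) (by positivity), Real.logb_one,
    Real.logb_mul (by norm_num) (by positivity),
    show (4 : ℝ) = 2 ^ 2 by norm_num, Real.logb_pow, Real.logb_self_eq_one one_lt_two]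
  push_cast
  ring

/-- **The certificate covers the support with equality**: at each of the `2r + 1` support points the
weight product is `(1/2)(1/2)(1/(r²+1)) = (1/(2r))(1/2)(r/(r²+1)) = 1/(4(r²+1)) = θ_r³` (`r ≥ 1`).
[cite: KassabovEtAl2026, Ex. 2.2] -/
theorem ccWeight_supp (hr : 1 ≤ r) : ∀ a b c, cornerTensor K r a b c ≠ 0 →
    ccTheta r ^ 3 ≤ ccWeightAB r a * ccWeightAB r b * ccWeightC r c := by
  have hr0 : (r : ℝ) ≠ 0 := by exact_mod_cast (show r ≠ 0 by omega)
  intro a b c h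
  rw [ccTheta_pow_three]
  rcases a with u | k <;> rcases b with u' | k' <;> rcases c with u'' | k'' <;>
    simp only [corner_llr, corner_lrl, corner_rll, corner_rr, ne_eq, not_true_eq_false] at h <;>
    simp only [ccWeightAB, ccWeightC, Sum.elim_inl, Sum.elim_inr] <;> apply le_of_eq <;>
    field_simp <;> ring

/-- **`T_{1,1,r} ≥ ⟨2⟩`** (`r ≥ 2`): restrict to `a ∈ {a_1, a₀}`, `b ∈ {b₀, b_2}`, `c ∈ {c_1, c_2}`.
[folklore] -/
theorem tensorRestrictsTo_corner_unitTensor_two (hr : 2 ≤ r) :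
    TensorRestrictsTo (kroneckerPow (cornerTensor K r) 1) (unitTensor K 2) := by
  set k₀ : Fin r := ⟨0, by omega⟩ with hk₀
  set k₁ : Fin r := ⟨1, by omega⟩ with hk₁
  set fA : Fin 2 → CIdx r := ![Sum.inr k₀, Sum.inl ()] with hfA
  set fB : Fin 2 → CIdx r := ![Sum.inl (), Sum.inr k₁] with hfB
  set fC : Fin 2 → CIdx r := ![Sum.inr k₀, Sum.inr k₁] with hfC
  have key : unitTensor K 2 = fun x y z => kroneckerPow (cornerTensor K r) 1
      (fun _ => fA x) (fun _ => fB y) (fun _ => fC z) := by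
    funext x y z
    fin_cases x <;> fin_cases y <;> fin_cases z <;>
      simp [kroneckerPow_apply, hfA, hfB, hfC, hk₀, hk₁, Fin.ext_iff]
  rw [key]
  exact tensorRestrictsTo_precomp _ _ _ _

/-- `2 + log₂(r²+1) > 0`. [folklore] -/
theorem ccExponent_pos (r : ℕ) : 0 < 2 + Real.logb 2 ((r : ℝ) ^ 2 + 1) := by
  have h : 0 ≤ Real.logb 2 ((r : ℝ) ^ 2 + 1) :=
    Real.logb_nonneg one_lt_two (by nlinarith [sq_nonneg (r : ℝ)])
  linarith

/-- **`ω(T_{1,1,r}, ⟨2⟩) ≥ 3/(2 + log₂(r²+1))`**, i.e. `Q̃(T_{1,1,r}) ≤ (4(r²+1))^{1/3}` (`r ≥ 2`).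
[cite: ChristandlVranaZuiddam2021, §4.2] -/
theorem inv_le_relativeExponent_cornerTensor_unit (hr : 2 ≤ r) :
    3 / (2 + Real.logb 2 ((r : ℝ) ^ 2 + 1)) ≤
      relativeExponent (cornerTensor K r) (unitTensor K 2) := by
  have hr1 : 1 ≤ r := by omega
  have h := inv_logb_le_relativeExponent_of_weights (cornerTensor K r) (ccWeightAB r) (ccWeightAB r)
    (ccWeightC r) (ccWeightAB_nonneg r) (ccWeightAB_nonneg r) (ccWeightC_nonneg r)
    (sum_ccWeightAB hr1).le (sum_ccWeightAB hr1).le (sum_ccWeightC r).le (ccTheta_pos r)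
    (ccTheta_lt_one r) (ccWeight_supp (K := K) hr1) (tensorRestrictsTo_corner_unitTensor_two hr)
  rw [logb_inv_ccTheta r, one_div_div] at h
  exact h

/-! ## Irreversibility and the barrier -/

/-- **`2 i(T_{1,1,r}) ≥ 6 log₂(r+1) / (2 + log₂(r²+1))`** (`r ≥ 2`).
[cite: ChristandlVranaZuiddam2021, Def. 4 and Prop. 17] -/
theorem two_irreversibility_cornerTensor_ge (hr : 2 ≤ r) :
    6 * Real.logb 2 ((r : ℝ) + 1) / (2 + Real.logb 2 ((r : ℝ) ^ 2 + 1)) ≤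
      2 * irreversibility (cornerTensor K r) := by
  have hc := ccExponent_pos r
  have hA := logb_le_relativeExponent_unit_cornerTensor (K := K) (r := r)
  have hB := inv_le_relativeExponent_cornerTensor_unit (K := K) hr
  have hr0 : (0 : ℝ) ≤ r := by exact_mod_cast (Nat.zero_le r)
  have hlog0 : 0 ≤ Real.logb 2 ((r : ℝ) + 1) := Real.logb_nonneg one_lt_two (by linarith)
  have hprod : Real.logb 2 ((r : ℝ) + 1) * (3 / (2 + Real.logb 2 ((r : ℝ) ^ 2 + 1)))
      ≤ irreversibility (cornerTensor K r) := by
    unfold irreversibility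
    exact mul_le_mul hA hB (by positivity) (relativeExponent_nonneg _ _)
  calc 6 * Real.logb 2 ((r : ℝ) + 1) / (2 + Real.logb 2 ((r : ℝ) ^ 2 + 1))
      = 2 * (Real.logb 2 ((r : ℝ) + 1) * (3 / (2 + Real.logb 2 ((r : ℝ) ^ 2 + 1)))) := by ring
    _ ≤ 2 * irreversibility (cornerTensor K r) := by linarith

/-- `T_{1,1,r}` is not a triad (`r ≥ 1`): the entries at `(a₀,b₀,c₀)`, `(a₀,b₀,c_1)`, `(a₀,b_1,c_1)`
are `1, 0, 1`. [folklore] -/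
theorem cornerTensor_ne_triad (hr : 1 ≤ r) (w u v : CIdx r → K) :
    cornerTensor K r ≠ triad w u v := by
  intro h
  set k : Fin r := ⟨0, by omega⟩ with hk
  have h1 := congrFun (congrFun (congrFun h (Sum.inl ())) (Sum.inl ())) (Sum.inl ())
  have h2 := congrFun (congrFun (congrFun h (Sum.inl ())) (Sum.inl ())) (Sum.inr k)
  have h3 := congrFun (congrFun (congrFun h (Sum.inl ())) (Sum.inr k)) (Sum.inr k)
  simp only [corner_lll, corner_llr, corner_lrr, triad_apply, if_true] at h1 h2 h3
  rcases mul_eq_zero.1 h2.symm with hwu | hv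
  · rw [hwu] at h1; simp at h1
  · rw [hv] at h3; simp at h3

/-- **The irreversibility barrier for the corner big centroid tensors** (any field, `r ≥ 2`): every
upper bound on `ω` certified through the fixed intermediate tensor `T_{1,1,r}` is at least
`6 log₂(r+1) / (2 + log₂(r²+1))` (`2.2004, 2.2548, 2.2886, 2.3147, 2.3364, 2.3548` for `r = 2, …, 7`;
KLSS's laser values are `2.55265, 2.46836, 2.46016, 2.46710, 2.47793, 2.48946`).
[cite: ChristandlVranaZuiddam2021, Thm. 9] [cite: KassabovEtAl2026, §8 Table 1] -/
theorem irreversibilityBarrier_corner (K : Type) [Field K] (hr : 2 ≤ r) :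
    6 * Real.logb 2 ((r : ℝ) + 1) / (2 + Real.logb 2 ((r : ℝ) ^ 2 + 1)) ≤
      relativeExponent (unitTensor K 2) (cornerTensor K r) *
        relativeExponent (cornerTensor K r) (matMulTensor K 2 2 2) :=
  (two_irreversibility_cornerTensor_ge hr).trans
    (IrreversibilityBarrier_holds.thm9 K (cornerTensor K r) (cornerTensor_ne_triad (by omega)))

/-- The barrier value exceeds `2` for every `r ≥ 2`: `4(r²+1) < (r+1)³`, i.e. `(r−1)(r²+3) > 0`.
[folklore] -/
theorem two_lt_cornerBarrierValue (hr : 2 ≤ r) :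
    2 < 6 * Real.logb 2 ((r : ℝ) + 1) / (2 + Real.logb 2 ((r : ℝ) ^ 2 + 1)) := by
  have hc := ccExponent_pos r
  have hr2 : (2 : ℝ) ≤ r := by exact_mod_cast hr
  rw [lt_div_iff₀ hc]
  suffices h : 2 + Real.logb 2 ((r : ℝ) ^ 2 + 1) < 3 * Real.logb 2 ((r : ℝ) + 1) by linarith
  have key : (4 : ℝ) * ((r : ℝ) ^ 2 + 1) < ((r : ℝ) + 1) ^ 3 := by
    nlinarith [mul_pos (by linarith : (0 : ℝ) < (r : ℝ) - 1) (by positivity : (0 : ℝ) < (r : ℝ) ^ 2 + 3)]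
  have hlog := Real.logb_lt_logb one_lt_two (by positivity) key
  rw [Real.logb_mul (by norm_num) (by positivity), Real.logb_pow,
    show (4 : ℝ) = 2 ^ 2 by norm_num, Real.logb_pow, Real.logb_self_eq_one one_lt_two] at hlog
  push_cast at hlog
  linarith

/-- **No corner big centroid tensor can prove `ω = 2`**: through `T_{1,1,r}` (`r ≥ 2`, any field)
the certified bound `ω(⟨2⟩, T_{1,1,r}) · ω(T_{1,1,r}, ⟨2,2,2⟩)` is `> 2` — with or without Kronecker
powers. [cite: ChristandlVranaZuiddam2021, §3.1] [cite: KassabovEtAl2026, §8 and p. 37] -/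
theorem irreversibilityBarrier_corner_gt_two (K : Type) [Field K] (hr : 2 ≤ r) :
    2 < relativeExponent (unitTensor K 2) (cornerTensor K r) *
      relativeExponent (cornerTensor K r) (matMulTensor K 2 2 2) :=
  (two_lt_cornerBarrierValue hr).trans_le (irreversibilityBarrier_corner K hr)

end BigCentroidCorner

end Summit.MatrixMultiplication.MatrixMultiplication.Theorems
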